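import Summits.ValiantsHypothesis.ValiantsHypothesis.Theorems.BarrierLeverDefinableDcEquationsConeHyperplane
import Literature.RingTheory.MvPolynomial.IdealHomogenization
import Literature.Computability.AlgebraicComplexity.VonZurGathenRegularityProofs
import Literature.Computability.AlgebraicComplexity.ABV17SingularLocusBound

/-!
# Route BarrierLever — the pencil of an affine determinantal representation and its corank-2
# cone: singular points at infinity of the top form (crux `DefinableDcEquations`, stmt-8746)

Support file for the Kumar–Volk-type sharpening of the `dc ≤ n + k` rung.  For an affine square
matrix `A = A₀ + A₁(x)` over `ℂ[x₁..x_w]` its **pencil** is the matrix of linear forms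
`A.map (homogenizeTo 1) = x₀ A₀ + A₁(x)` over `ℂ[x₀, x₁, …, x_w]` (`x₀ = X none`, the tree's
`IdealHomogenization.homogenizeTo`), with `det = homogenizeTo m (det A)`
(`det_map_homogenizeTo_one`) `= x₀^(m-n) · homogenizeTo n (det A)` when `deg det A ≤ n`.

* `aeval_elim_zero_homogenizeTo` — at infinity (`x₀ = 0`) `homogenizeTo n f` becomes the
  degree-`n` component `hc_n f`; `aeval_elim_zero_pderiv_some` — setting `x₀ = 0` commutes with
  `∂/∂x_i`; `eval_elim_zero` — evaluation bookkeeping.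
* **`exists_ne_zero_grad_eq_zero_of_not_mem_minimalPrime`** ("case A"): if some minimal prime `𝔭`
  of the ideal `I_{m-1}` of submaximal minors of the pencil (the corank-`≥ 2` cone, of height
  `≤ 4` by Eagon–Northcott, `VonZurGathen.height_le_four_of_mem_minimalPrimes_adjIdeal`) does NOT
  contain `x₀`, then — since `det` and all `∂ det` of the pencil lie in `I_{m-1}`, and `x₀ ∉ 𝔭`
  lets one cancel the factor `x₀^(m-n)` — the form `G = homogenizeTo n (det A)` and its
  `x`-gradient lie in `𝔭`, and the cone `V(𝔭)` (projective dimension `≥ w - 4 ≥ 1`) meets the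
  hyperplane `x₀ = 0` (`exists_ne_zero_none_eq_zero_of_isPrime`): a point `ζ ≠ 0` with
  `∇(hc_n det A)(ζ) = 0`.
* `adjugate_map_eval_ne_zero_of_X_mem_radical` ("towards case B"): if instead `x₀` lies in every
  minimal prime of `I_{m-1}` (i.e. in its radical), then `adj A(v) ≠ 0` at EVERY point `v`: the
  affine matrix has corank `≤ 1` everywhere (von zur Gathen / Alper–Bogart–Velasco regularity,
  here unconditionally as the complementary case).

Nothing here bears on `VP` vs `VNP`.  No definitions, no named-fact hypotheses; standard axioms.

References: J. von zur Gathen, *Permanent and determinant*, Linear Algebra Appl. 96 (1987)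
[Vonzurgathen1987]; M. Kumar, B. L. Volk, *A lower bound on determinantal complexity*, comput.
complexity 31 (2022), Lemma 8 [KumarVolk2022b]; Cox–Little–O'Shea, *Ideals, Varieties, and
Algorithms*, Ch. 8 §2 Prop. 7 [CoxLittleOShea2007].
-/

-- layout Summits/ValiantsHypothesis/ValiantsHypothesis forces the duplicated namespace component
set_option linter.dupNamespace false

noncomputable section

open MvPolynomial Matrix

namespace Summit.ValiantsHypothesis.ValiantsHypothesis.Theorems.BarrierLever.DcConstantExcess

open Literature.RingTheory.MvPolynomial.IdealHomogenization
open Literature.Computability.AlgebraicComplexity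
open Literature.RingTheory.MvPolynomial

variable {w : ℕ}

/-! ## §1 Setting `x₀ = 0`: bookkeeping -/

/-- At infinity the padded homogenization `homogenizeTo n f` (`deg f ≤ n`) is the degree-`n`
component of `f`. [cite: CoxLittleOShea2007, Ch.8 §2 Prop. 7 (i)] -/
theorem aeval_elim_zero_homogenizeTo {n : ℕ} (f : MvPolynomial (Fin w) ℂ) (hf : f.totalDegree ≤ n) :
    aeval (fun o : Option (Fin w) => (o.elim 0 X : MvPolynomial (Fin w) ℂ)) (homogenizeTo n f) =
      homogeneousComponent n f := by
  rw [homogenizeTo_eq_X_pow_mul hf, map_mul, map_pow, aeval_zero_homogenization, aeval_X]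
  rcases Nat.eq_or_lt_of_le hf with h | h
  · rw [h, Nat.sub_self, pow_zero, one_mul]
  · rw [homogeneousComponent_eq_zero n f h]
    have : n - f.totalDegree ≠ 0 := by omega
    simp [zero_pow this]

/-- Setting `x₀ = 0` commutes with `∂/∂x_i`. [folklore] -/
theorem aeval_elim_zero_pderiv_some (q : MvPolynomial (Option (Fin w)) ℂ) (i : Fin w) :
    aeval (fun o : Option (Fin w) => (o.elim 0 X : MvPolynomial (Fin w) ℂ)) (pderiv (some i) q) =
      pderiv i (aeval (fun o : Option (Fin w) => (o.elim 0 X : MvPolynomial (Fin w) ℂ)) q) := by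
  induction q using MvPolynomial.induction_on with
  | C c => simp
  | add p q hp hq => simp only [map_add, hp, hq]
  | mul_X p o hp =>
    rw [(pderiv (some i)).leibniz, smul_eq_mul, smul_eq_mul, map_add, map_mul, map_mul, hp,
      map_mul, (pderiv i).leibniz, smul_eq_mul, smul_eq_mul]
    congr 1
    rw [pderiv_X, aeval_X]
    cases o with
    | none => simp
    | some j =>
      by_cases hj : j = i
      · subst hj; simp [pderiv_X]
      · have : (some j : Option (Fin w)) ≠ some i := fun h => hj (Option.some_injective _ h)
        simp [Pi.single_eq_of_ne this, Pi.single_eq_of_ne hj, pderiv_X]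

/-- Evaluating at a point `(0, ζ)` of the hyperplane at infinity is evaluating the restriction
at `ζ`. [folklore] -/
theorem eval_elim_zero (q : MvPolynomial (Option (Fin w)) ℂ) (ζ : Fin w → ℂ) :
    eval (fun o : Option (Fin w) => (o.elim 0 ζ : ℂ)) q =
      eval ζ (aeval (fun o : Option (Fin w) => (o.elim 0 X : MvPolynomial (Fin w) ℂ)) q) := by
  induction q using MvPolynomial.induction_on with
  | C c => simp
  | add p q hp hq => simp only [map_add, hp, hq]
  | mul_X p o hp => cases o <;> simp [hp]

/-! ## §2 The pencil of an affine matrix -/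

/-- **The determinant of the pencil** `x₀ A₀ + A₁(x)` of an `m × m` affine matrix `A` is the padded
homogenization `homogenizeTo m (det A)` (both are forms of degree `m` dehomogenizing to `det A`).
[cite: CoxLittleOShea2007, Ch.8 §2 Prop. 7 (iv)] -/
theorem det_map_homogenizeTo_one {m : ℕ} (A : Matrix (Fin m) (Fin m) (MvPolynomial (Fin w) ℂ))
    (hA : ∀ i j, (A i j).totalDegree ≤ 1) :
    (A.map (homogenizeTo 1)).det = homogenizeTo m A.det := by
  have hhom : (A.map (homogenizeTo 1)).det.IsHomogeneous m := by
    simpa [Fintype.card_fin] using AlperBogartVelasco.isHomogeneous_det_of_linear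
      (A.map (homogenizeTo 1)) (fun i j => homogenizeTo_isHomogeneous (hA i j))
  refine eq_homogenizeTo_of_isHomogeneous hhom ?_
  rw [AlgHom.map_det]
  congr 1
  ext i j
  simp [dehomogenization_homogenizeTo]

/-- The entries of the pencil are linear forms. [cite: CoxLittleOShea2007, Ch.8 §2 Prop. 7 (i)] -/
theorem isHomogeneous_map_homogenizeTo_one {m : ℕ}
    (A : Matrix (Fin m) (Fin m) (MvPolynomial (Fin w) ℂ)) (hA : ∀ i j, (A i j).totalDegree ≤ 1)
    (i j : Fin m) : ((A.map (homogenizeTo 1)) i j).IsHomogeneous 1 :=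
  homogenizeTo_isHomogeneous (hA i j)

/-- The ideal `I_{m-1}` of submaximal minors of a matrix of linear forms (size `m ≥ 1`) is
homogeneous. [folklore] -/
theorem isHomogeneous_adjIdeal_of_linear {m : ℕ}
    (P : Matrix (Fin (m + 1)) (Fin (m + 1)) (MvPolynomial (Option (Fin w)) ℂ))
    (hP : ∀ i j, (P i j).IsHomogeneous 1) :
    letI : GradedAlgebra (homogeneousSubmodule (Option (Fin w)) ℂ) := MvPolynomial.gradedAlgebra
    (VonZurGathen.adjIdeal P).IsHomogeneous (homogeneousSubmodule (Option (Fin w)) ℂ) := by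
  classical
  letI : GradedAlgebra (homogeneousSubmodule (Option (Fin w)) ℂ) := MvPolynomial.gradedAlgebra
  refine Ideal.homogeneous_span (𝒜 := homogeneousSubmodule (Option (Fin w)) ℂ) _ ?_
  rintro _ ⟨⟨i, j⟩, rfl⟩
  refine ⟨0 + m, (mem_homogeneousSubmodule _ _).2 ?_⟩
  show (P.adjugate i j).IsHomogeneous (0 + m)
  rw [Matrix.adjugate_fin_succ_eq_det_submatrix]
  refine IsHomogeneous.mul ?_ ?_
  · have : ((-1 : MvPolynomial (Option (Fin w)) ℂ) ^ (j + i : ℕ)) = C ((-1 : ℂ) ^ (j + i : ℕ)) := by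
      rw [map_pow, map_neg, map_one]
    rw [this]
    exact isHomogeneous_C _ _
  · simpa [Fintype.card_fin] using AlperBogartVelasco.isHomogeneous_det_of_linear
      (P.submatrix j.succAbove i.succAbove) (fun a b => hP _ _)

/-! ## §3 Case A: a component of the corank-2 cone of the pencil off the hyperplane `x₀ = 0` -/

/-- **Singular points at infinity of the top form, case A.**  Let `A` be an affine `m × m` matrix
over `ℂ[x₁..x_w]` (`m ≥ 2`, `w ≥ 5`) with `deg det A ≤ n ≤ m`, and let `𝔭` be a minimal prime of
the ideal of submaximal minors of its pencil with `x₀ ∉ 𝔭`.  Then the gradient of the degree-`n`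
component of `det A` has a NONZERO common zero.  (`det` and `∂ det` of the pencil lie in
`I_{m-1} ⊆ 𝔭`; `det = x₀^(m-n) G` with `G = homogenizeTo n (det A)`, so `G, ∂_{x_i} G ∈ 𝔭` as
`x₀ ∉ 𝔭`; `height 𝔭 ≤ 4 < w` by Eagon–Northcott, so the cone `V(𝔭)` has a point `(0, ζ)`,
`ζ ≠ 0`, and `∂_i G (0, ·) = ∂_i hc_n (det A)`.) [cite: KumarVolk2022b, Lemma 8] -/
theorem exists_ne_zero_grad_eq_zero_of_not_mem_minimalPrime {m n : ℕ} (hw : 5 ≤ w) (hm : 2 ≤ m)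
    (A : Matrix (Fin m) (Fin m) (MvPolynomial (Fin w) ℂ)) (hA : ∀ i j, (A i j).totalDegree ≤ 1)
    (hdeg : A.det.totalDegree ≤ n) (hnm : n ≤ m)
    {𝔭 : Ideal (MvPolynomial (Option (Fin w)) ℂ)}
    (h𝔭 : 𝔭 ∈ (VonZurGathen.adjIdeal (A.map (homogenizeTo 1))).minimalPrimes)
    (hX : (X none : MvPolynomial (Option (Fin w)) ℂ) ∉ 𝔭) :
    ∃ ζ : Fin w → ℂ, ζ ≠ 0 ∧ ∀ i, eval ζ (pderiv i (homogeneousComponent n A.det)) = 0 := by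
  classical
  letI : GradedAlgebra (homogeneousSubmodule (Option (Fin w)) ℂ) := MvPolynomial.gradedAlgebra
  obtain ⟨m', rfl⟩ : ∃ m', m = m' + 2 := ⟨m - 2, by omega⟩
  haveI h𝔭p : 𝔭.IsPrime := h𝔭.1.1
  set P := A.map (homogenizeTo 1) with hPdef
  set G := homogenizeTo n A.det with hGdef
  have hle : VonZurGathen.adjIdeal P ≤ 𝔭 := h𝔭.1.2
  -- `det P = x₀^(m-n) · G`
  have hdetP : P.det = X none ^ (m' + 2 - n) * G := by
    rw [hPdef, det_map_homogenizeTo_one A hA, hGdef, ← homogenizeTo_add_right hdeg (m' + 2 - n)]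
    congr 1
    omega
  -- cancelling powers of `x₀` modulo `𝔭`
  have hcancel : ∀ (e : ℕ) (q : MvPolynomial (Option (Fin w)) ℂ), X none ^ e * q ∈ 𝔭 → q ∈ 𝔭 := by
    intro e q h
    rcases h𝔭p.mem_or_mem h with h1 | h2
    · exact absurd (h𝔭p.mem_of_pow_mem e h1) hX
    · exact h2
  have hG : G ∈ 𝔭 := hcancel _ _ (hdetP ▸ hle (VonZurGathen.det_mem_adjIdeal P))
  have hdG : ∀ i : Fin w, pderiv (some i) G ∈ 𝔭 := by
    intro i
    have h := hle (VonZurGathen.derivation_det_mem_adjIdeal (pderiv (some i)) P)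
    rw [hdetP, (pderiv (some i)).leibniz, smul_eq_mul, smul_eq_mul, (pderiv (some i)).leibniz_pow,
      pderiv_X, Pi.single_eq_of_ne (by simp : (none : Option (Fin w)) ≠ some i), smul_zero,
      smul_zero, mul_zero, add_zero] at h
    exact hcancel _ _ h
  -- `𝔭` is homogeneous of height `≤ 4 < w`
  have h𝔭hom : 𝔭.IsHomogeneous (homogeneousSubmodule (Option (Fin w)) ℂ) :=
    isHomogeneous_of_mem_minimalPrimes
      (isHomogeneous_adjIdeal_of_linear P (isHomogeneous_map_homogenizeTo_one A hA)) h𝔭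
  have hht : 𝔭.height < w := by
    have h4 := VonZurGathen.height_le_four_of_mem_minimalPrimes_adjIdeal m' P h𝔭
    exact lt_of_le_of_lt h4 (by exact_mod_cast (show (4 : ℕ) < w by omega))
  obtain ⟨ξ, hξ0, hξn, hξ⟩ := exists_ne_zero_none_eq_zero_of_isPrime h𝔭hom hX hht
  refine ⟨ξ ∘ some, hξ0, fun i => ?_⟩
  have hξeq : ξ = fun o : Option (Fin w) => (o.elim 0 (ξ ∘ some) : ℂ) := by
    funext o; cases o with
    | none => exact hξn
    | some j => rfl
  have h := hξ _ (hdG i)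
  rw [hξeq, eval_elim_zero, aeval_elim_zero_pderiv_some, hGdef,
    aeval_elim_zero_homogenizeTo _ hdeg] at h
  exact h

/-! ## §4 Towards case B: if `x₀` lies in the radical of `I_{m-1}`, the affine matrix is regular -/

/-- **Regularity in case B.**  If `x₀` lies in the radical of the ideal of submaximal minors of
the pencil of `A` (equivalently: in every minimal prime — the corank-`≥ 2` cone lies inside the
hyperplane `x₀ = 0`), then `adj A(v) ≠ 0` at EVERY point `v`, i.e. `A(v)` has corank `≤ 1`
everywhere (evaluate `x₀^N ∈ I_{m-1}` at the point `(1, v)`). [cite: KumarVolk2022b, Lemma 8] -/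
theorem adjugate_map_eval_ne_zero_of_X_mem_radical {m : ℕ}
    (A : Matrix (Fin m) (Fin m) (MvPolynomial (Fin w) ℂ))
    (hrad : (X none : MvPolynomial (Option (Fin w)) ℂ) ∈
      (VonZurGathen.adjIdeal (A.map (homogenizeTo 1))).radical)
    (v : Fin w → ℂ) : (A.map (eval v)).adjugate ≠ 0 := by
  classical
  obtain ⟨N, hN⟩ := (Ideal.mem_radical_iff.1 hrad)
  let ev : MvPolynomial (Option (Fin w)) ℂ →+* ℂ := eval fun o : Option (Fin w) => (o.elim 1 v : ℂ)
  have hmap : ev.mapMatrix (A.map (homogenizeTo 1)) = A.map (eval v) := by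
    ext i j
    simp only [RingHom.mapMatrix_apply, Matrix.map_apply, ev]
    rw [eval_one_elim, dehomogenization_homogenizeTo]
  have h1 : (1 : ℂ) ∈ VonZurGathen.adjIdeal (A.map (eval v)) := by
    rw [← hmap, ← VonZurGathen.adjIdeal_map]
    have := Ideal.mem_map_of_mem ev hN
    simpa [ev] using this
  intro hadj
  have hbot : VonZurGathen.adjIdeal (A.map (eval v)) = ⊥ := by
    rw [VonZurGathen.adjIdeal, Ideal.span_eq_bot]
    rintro _ ⟨p, rfl⟩
    rw [hadj]; rfl
  rw [hbot, Ideal.mem_bot] at h1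
  exact one_ne_zero h1

end Summit.ValiantsHypothesis.ValiantsHypothesis.Theorems.BarrierLever.DcConstantExcess

end
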